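import Literature.MathematicalPhysics.QuantumLattice.PairCorrelationsProofs
import HarnessLib

/-!
# Crux `MesoscopicPairOrder` (item `stmt-HubbardSuperconductivity-7331`), line `Sketch` — stub `stub_boxExpectation`

Helper file (lands `--supports stmt-HubbardSuperconductivity-7331`; the composition lives in the
lead's skeleton of line `Sketch`, route `FunctionFieldCertificate`). It proves the bookkeeping
identity between the expectation of the BOX PAIR REPULSION written inline,
`K_R = Σ_{x,y} W_R(y - x) • (P_xᴴ P_y)` with `W_R(z) = Πᵢ (1 - |zᵢ|_L/R)₊` and
`P_x = localPair dWaveFormFactor L x`, and the Fejér-box pair correlation of the crux: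

  `Re⟨ψ, K_R ψ⟩ = T_R(ψ) = Σ_{x,y} W_R(y - x) Re⟨P_x ψ, P_y ψ⟩`.

* `re_star_dotProduct_sum_sum_smul_conjTranspose_mul_mulVec` — the model-free identity for an
  arbitrary real weight `w : X → X → ℝ`, an arbitrary family of square matrices `P : X → Matrix n n ℂ`
  and any vector `ψ` (push `*ᵥ`, `⬝ᵥ` and `re` through the two finite sums and the real scalar,
  then `⟨ψ, (Xᴴ Y) ψ⟩ = ⟨X ψ, Y ψ⟩`);
* `stub_boxExpectation` — its specialisation to the torus `(ℤ/Lℤ)²`, the tent weight `W_R` and the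
  `d`-wave local pairs, in the exact registered form.

No definition is introduced; folklore (Yang, Rev. Mod. Phys. 34 (1962) 694, §3: `⟨ψ, Xᴴ Y ψ⟩` as a
Gram entry; linearity of the expectation).
-/

noncomputable section

-- the summit namespace repeats the problem name by design (D-0017)
set_option linter.dupNamespace false

namespace Summit.HubbardSuperconductivity.HubbardSuperconductivity.Theorems.FunctionFieldCertificate

open Matrix Finset Filter
open Literature.Probability.LatticeModels Literature.MathematicalPhysics.QuantumLattice
open scoped ComplexOrder

/-- `⟨ψ, (Xᴴ Y) ψ⟩ = ⟨X ψ, Y ψ⟩` for square complex matrices on any finite index type (the Gram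
form of a product expectation). Yang, Rev. Mod. Phys. 34 (1962) 694, §3. [folklore] -/
theorem star_dotProduct_conjTranspose_mul_mulVec {n : Type*} [Fintype n]
    (X Y : Matrix n n ℂ) (ψ : n → ℂ) :
    star ψ ⬝ᵥ (Xᴴ * Y) *ᵥ ψ = star (X *ᵥ ψ) ⬝ᵥ Y *ᵥ ψ := by
  rw [← Matrix.mulVec_mulVec, Matrix.dotProduct_mulVec, Matrix.star_mulVec]

/-- The model-free box-expectation identity: for a real weight `w`, a family of square matrices
`P x` and a vector `ψ`,
`Re⟨ψ, (Σ_{x,y} w(x,y) • (P_xᴴ P_y)) ψ⟩ = Σ_{x,y} w(x,y) Re⟨P_x ψ, P_y ψ⟩`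
(linearity of `A ↦ ⟨ψ, A ψ⟩`, the Gram form `⟨ψ, P_xᴴ P_y ψ⟩ = ⟨P_x ψ, P_y ψ⟩`, and
`Re (r z) = r Re z` for real `r`). Yang, Rev. Mod. Phys. 34 (1962) 694, §3. [folklore] -/
theorem re_star_dotProduct_sum_sum_smul_conjTranspose_mul_mulVec {n X : Type*} [Fintype n]
    [Fintype X] (w : X → X → ℝ) (P : X → Matrix n n ℂ) (ψ : n → ℂ) :
    (star ψ ⬝ᵥ (∑ x : X, ∑ y : X, ((w x y : ℝ) : ℂ) • ((P x)ᴴ * P y)) *ᵥ ψ).re =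
      ∑ x : X, ∑ y : X, w x y * (star (P x *ᵥ ψ) ⬝ᵥ (P y *ᵥ ψ)).re := by
  simp only [Matrix.sum_mulVec, dotProduct_sum, Matrix.smul_mulVec, dotProduct_smul,
    Complex.re_sum, smul_eq_mul, Complex.re_ofReal_mul,
    star_dotProduct_conjTranspose_mul_mulVec]

/-- **Stub `stub_boxExpectation`** of line `Sketch` (bookkeeping). For every side `L`, scale `R`
and vector `ψ`: `Re⟨ψ, K_R ψ⟩ = T_R(ψ)`, where
`K_R = Σ_{x,y} W_R(y - x) • (P_xᴴ P_y)` is the box pair repulsion written inline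
(`W_R(z) = Πᵢ (1 - |zᵢ|_L/R)₊`, `P_x = localPair dWaveFormFactor L x`) and
`T_R(ψ) = Σ_{x,y} W_R(y - x) Re⟨P_x ψ, P_y ψ⟩` is literally the double sum of route item
`MesoscopicPairOrder` (`⟨ψ, P_xᴴ P_y ψ⟩ = ⟨P_x ψ, P_y ψ⟩`, real weights): the specialisation of
`re_star_dotProduct_sum_sum_smul_conjTranspose_mul_mulVec` to the torus `(ℤ/Lℤ)²`, the tent
weight and the `d`-wave local pairs. Yang, Rev. Mod. Phys. 34 (1962) 694, §3. [folklore] -/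
theorem stub_boxExpectation : ∀ (L : ℕ) [NeZero L] (R : ℕ) (ψ : Fock (Orb (FermionTorus 2 L))),
    (star ψ ⬝ᵥ (∑ x : TorusSite 2 L, ∑ y : TorusSite 2 L,
        ((∏ i : Fin 2, max 0 (1 - |(((y i - x i).valMinAbs : ℤ) : ℝ)| / (R : ℝ)) : ℝ) : ℂ) •
          ((localPair dWaveFormFactor L x)ᴴ * localPair dWaveFormFactor L y)) *ᵥ ψ).re =
      ∑ x : TorusSite 2 L, ∑ y : TorusSite 2 L,
        (∏ i : Fin 2, max 0 (1 - |(((y i - x i).valMinAbs : ℤ) : ℝ)| / (R : ℝ))) *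
          (star (localPair dWaveFormFactor L x *ᵥ ψ) ⬝ᵥ (localPair dWaveFormFactor L y *ᵥ ψ)).re :=
  fun L _ R ψ =>
    re_star_dotProduct_sum_sum_smul_conjTranspose_mul_mulVec
      (fun x y : TorusSite 2 L =>
        ∏ i : Fin 2, max 0 (1 - |(((y i - x i).valMinAbs : ℤ) : ℝ)| / (R : ℝ)))
      (fun x => localPair dWaveFormFactor L x) ψ

end Summit.HubbardSuperconductivity.HubbardSuperconductivity.Theorems.FunctionFieldCertificate
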